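import Summits.Ventures.LatticeQCDFlow.Exactness.Phi4FlowSquareIntegrableSticking
import Summits.Ventures.LatticeQCDFlow.Exactness.FlowSamplerSquareIntegrableAcceptanceCeiling
import Summits.Ventures.LatticeQCDFlow.Exactness.Phi4FlowSquareIntegrableCeiling
import HarnessLib

/-!
# THE DICHOTOMY FOR EVERY SQUARE-INTEGRABLE OBSERVABLE OF THE EXACT FLOW SAMPLER: the autocorrelation series is summable IFF the sticking column `S_g = E_{g²}[r/(1 − r)]` is finite

HONEST FRAMING: exact (Metropolis-corrected) sampling algorithms for lattice gauge theory;
figures of merit are autocorrelation/cost numbers at stated couplings and volumes; no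
continuum-physics claim.  (SCALAR calibration rung S0-A: not a gauge result.)

Venture `LatticeQCDFlow` (cell pub-lqcd), topic `Exactness`; FANOUT row 2 (`s0-phi4`, FLOW arm
`K = imhOp μ w q̃`; lattice `imhOpPhi4 J λ q̃`, every `λ > 0`, real `J`, EVERY positive measurable model
density with `∫ q̃ = 1`).  NEW WORK of the cell, composing two landed files: NECESSITY
(`Phi4FlowSquareIntegrableSticking.imhOp_integrable_stickingOdds_of_summable`: a summable series
forces `g² w r/(1 − r) ∈ L¹`) and SUFFICIENCY (`FlowSamplerSquareIntegrableAcceptanceCeiling.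
imhOp_tauInt_le_acceptanceCeiling_of_sq`: `G₂ = ∫ g² w/ρ < ∞` forces summability), glued by the
pointwise identity `g² w/ρ = g² w + g² w · r/(1 − r)` (`ρ = 1 − r > 0`).  The tree had the dichotomy
for BOUNDED observables in terms of the weight moment `W₂` (`IMHTauIntInfiniteOfWeightMoment.
phi4Flow_forall_summable_iff`, uniform over the class) and for ODD observables under a SYMMETRIC flow
(`Phi4FlowSymmetricMagnetisationExact.imhOp_summable_iff_of_odd`); this file states it observable by
observable on all of `L²(e^{−S})`, with no symmetry.  Nothing is cited as a fact.

## What is proved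

General (`w, q > 0` measurable integrable, `∫ q = 1`; `g` measurable, `∫ g² w < ∞`, `∫ g w = 0`,
`P = ∫ g² w > 0`; `r(x) = ∫ (1 − α(x,z)) q(z)` the rejection probability):
* `integrable_sq_mul_weight_div_acc_of_stickingColumn` — `g² w r/(1 − r) ∈ L¹ ⇒ g² w/ρ ∈ L¹`;
* **`imhOp_summable_iff_stickingColumn`** — the normalised autocorrelation series of `g` under `K` is
  SUMMABLE ⇔ `g² w · r/(1 − r) ∈ L¹` (`τ_int(g) < ∞ ⇔ S_g < ∞`).

Lattice (`Λ = Fin (n+1)`):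
* **`phi4Flow_summable_iff_stickingColumn_poly`** — every `f ∈ PolyObs` with `Var f > 0`;
* **`phi4Flow_magnetisation_summable_iff_stickingColumn`** — THE MAGNETISATION, for EVERY network:
  its series under the flow arm is summable iff `∫ M̃² e^{−S} r/(1 − r) < ∞` — configurations from
  which the flow proposal is almost surely rejected must carry summably little `M̃²`-mass, and that
  is the only obstruction.

NOT CLAIMED: any value of `r` or `S` for any network; the quantitative bracket (that is
`Phi4FlowSquareIntegrableBracket`); anything for the HMC / local arms.
-/

namespace Summit.Ventures.LatticeQCDFlow.Exactness

open Real MeasureTheory Filter Finset Set Topology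
open Summit.Ventures.LatticeQCDFlow.Scoring

section General

variable {X : Type*} [MeasurableSpace X] {μ : Measure X} [SFinite μ] {w q : X → ℝ}

omit [SFinite μ] in
/-- **A finite sticking column makes `G₂` finite**: `g² w ∈ L¹`, `g² w r/(1 − r) ∈ L¹` ⇒
`g² w/ρ ∈ L¹` — pointwise `g² w/ρ = g² w + g² w r/(1 − r)` with `ρ = 1 − r ∈ (0, 1]`. -/
theorem integrable_sq_mul_weight_div_acc_of_stickingColumn (hw0 : ∀ t, 0 < w t) (hwm : Measurable w)
    (hq0 : ∀ t, 0 < q t) (hqm : Measurable q) (hqi : Integrable q μ) (hq1 : ∫ z, q z ∂μ = 1)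
    {g : X → ℝ} (hg2 : Integrable (fun t => g t ^ 2 * w t) μ)
    (hS : Integrable (fun x => g x ^ 2 * w x * ((∫ z, (1 - imhAcceptQ w q x z) * q z ∂μ)
      / (1 - ∫ z, (1 - imhAcceptQ w q x z) * q z ∂μ))) μ) :
    Integrable (fun t => g t ^ 2 * w t / (1 - rejCurve μ w q (w t / q t))) μ := by
  have hlt : ∀ t, rejCurve μ w q (w t / q t) < 1 := fun t =>
    rejCurve_lt_one hw0 hwm hq0 hqm hqi hq1 (div_pos (hw0 t) (hq0 t))
  refine (hg2.add hS).congr (Eventually.of_forall fun t => ?_)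
  show g t ^ 2 * w t + g t ^ 2 * w t * ((∫ z, (1 - imhAcceptQ w q t z) * q z ∂μ)
      / (1 - ∫ z, (1 - imhAcceptQ w q t z) * q z ∂μ)) = g t ^ 2 * w t / (1 - rejCurve μ w q (w t / q t))
  rw [rejection_eq_rejCurve hw0 hq0 t]
  have h : (1 - rejCurve μ w q (w t / q t)) ≠ 0 := by linarith [hlt t]
  field_simp
  ring

/-- **THE DICHOTOMY ON `L²(w)`**: `g` measurable, `∫ g² w < ∞`, `∫ g w = 0`, `P = ∫ g² w > 0`.  The
normalised autocorrelation series of `g` under the exact flow sampler `K = imhOp μ w q` is summable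
IF AND ONLY IF `g² w · r/(1 − r) ∈ L¹(μ)` (necessity: `Phi4FlowSquareIntegrableSticking`; sufficiency:
the acceptance-weighted ceiling of `FlowSamplerSquareIntegrableAcceptanceCeiling`). -/
theorem imhOp_summable_iff_stickingColumn (hw0 : ∀ t, 0 < w t) (hwm : Measurable w)
    (hwi : Integrable w μ) (hq0 : ∀ t, 0 < q t) (hqm : Measurable q) (hqi : Integrable q μ)
    (hq1 : ∫ z, q z ∂μ = 1) {g : X → ℝ} (hgm : Measurable g)
    (hg2 : Integrable (fun t => g t ^ 2 * w t) μ) (hg0 : ∫ t, g t * w t ∂μ = 0)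
    (hP : 0 < ∫ t, g t ^ 2 * w t ∂μ) :
    (Summable fun n => (∫ x, g x * ((imhOp μ w q)^[n + 1] g) x * w x ∂μ) / ∫ x, g x ^ 2 * w x ∂μ) ↔
    Integrable (fun x => g x ^ 2 * w x * ((∫ z, (1 - imhAcceptQ w q x z) * q z ∂μ)
      / (1 - ∫ z, (1 - imhAcceptQ w q x z) * q z ∂μ))) μ :=
  ⟨fun hs => (imhOp_integrable_stickingOdds_of_summable hw0 hwm hwi hq0 hqm hqi hq1 hgm hg2 hs).1,
    fun hS => (imhOp_tauInt_le_acceptanceCeiling_of_sq hw0 hwm hwi hq0 hqm hqi hq1 hgm hg2 hg0 hP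
      (integrable_sq_mul_weight_div_acc_of_stickingColumn hw0 hwm hq0 hqm hqi hq1 hg2 hS)).1⟩

end General

/-! ## The lattice -/

section Lattice

variable {n : ℕ}

/-- **THE DICHOTOMY FOR EVERY POLYNOMIAL OBSERVABLE OF LATTICE φ⁴ UNDER THE FLOW ARM**: every
`λ > 0`, real `J`, positive measurable model density with `∫ q̃ = 1`; `f ∈ PolyObs` with `Var f > 0`,
`g = f − ⟨f⟩`.  The normalised autocorrelation series of `f` under `imhOpPhi4 J λ q̃` is summable iff
`∫ g² e^{−S} r/(1 − r) dφ < ∞`. -/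
theorem phi4Flow_summable_iff_stickingColumn_poly {lam : ℝ} (hlam : 0 < lam)
    (J : Fin (n + 1) → Fin (n + 1) → ℝ) {q : (Fin (n + 1) → ℝ) → ℝ} (hq0 : ∀ φ, 0 < q φ)
    (hqm : Measurable q) (hqi : Integrable q) (hq1 : ∫ φ, q φ = 1) {f : (Fin (n + 1) → ℝ) → ℝ}
    (hf : PolyObs f) (hP : 0 < ∫ φ, (f φ - gibbsExpect J lam f) ^ 2 * gibbsWeight J lam φ) :
    (Summable fun k => (∫ φ, (f φ - gibbsExpect J lam f)
        * ((imhOpPhi4 J lam q)^[k + 1] (fun ψ => f ψ - gibbsExpect J lam f)) φ * gibbsWeight J lam φ)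
        / ∫ φ, (f φ - gibbsExpect J lam f) ^ 2 * gibbsWeight J lam φ) ↔
    Integrable (fun φ : Fin (n + 1) → ℝ => (f φ - gibbsExpect J lam f) ^ 2 * gibbsWeight J lam φ
        * ((∫ φ', (1 - imhAcceptQ (gibbsWeight J lam) q φ φ') * q φ')
          / (1 - ∫ φ', (1 - imhAcceptQ (gibbsWeight J lam) q φ φ') * q φ'))) := by
  obtain ⟨hgm, hg2⟩ := polyObs_sq_integrable hlam J (polyObs_sub_const hf (gibbsExpect J lam f))
  have hg0 := integral_polyObs_sub_gibbsExpect hlam J hf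
  rw [imhOpPhi4_eq_imhOp]
  exact imhOp_summable_iff_stickingColumn (μ := volume) (fun φ => gibbsWeight_pos J lam φ)
    (continuous_gibbsWeight J lam).measurable (integrable_gibbsWeight hlam J) hq0 hqm hqi hq1 hgm hg2
    hg0 hP

/-- **THE MAGNETISATION'S DICHOTOMY, FOR EVERY NETWORK**: `M = Σ_x φ_x`, `M̃ = M − ⟨M⟩` (`Var M > 0`
from the tree): the autocorrelation series of `M` under the flow arm is summable — `τ_int(M)` is a
finite sum — iff `∫ M̃² e^{−S} r/(1 − r) dφ < ∞`. -/
theorem phi4Flow_magnetisation_summable_iff_stickingColumn {lam : ℝ} (hlam : 0 < lam)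
    (J : Fin (n + 1) → Fin (n + 1) → ℝ) {q : (Fin (n + 1) → ℝ) → ℝ} (hq0 : ∀ φ, 0 < q φ)
    (hqm : Measurable q) (hqi : Integrable q) (hq1 : ∫ φ, q φ = 1) :
    (Summable fun k => (∫ φ, ((∑ x, φ x) - gibbsExpect J lam (fun ψ => ∑ x, ψ x))
        * ((imhOpPhi4 J lam q)^[k + 1]
            (fun ψ => (∑ x, ψ x) - gibbsExpect J lam (fun ψ => ∑ x, ψ x))) φ * gibbsWeight J lam φ)
        / ∫ φ, ((∑ x, φ x) - gibbsExpect J lam (fun ψ => ∑ x, ψ x)) ^ 2 * gibbsWeight J lam φ) ↔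
    Integrable (fun φ : Fin (n + 1) → ℝ =>
      ((∑ x, φ x) - gibbsExpect J lam (fun ψ => ∑ x, ψ x)) ^ 2 * gibbsWeight J lam φ
        * ((∫ φ', (1 - imhAcceptQ (gibbsWeight J lam) q φ φ') * q φ')
          / (1 - ∫ φ', (1 - imhAcceptQ (gibbsWeight J lam) q φ φ') * q φ'))) :=
  phi4Flow_summable_iff_stickingColumn_poly hlam J hq0 hqm hqi hq1 polyObs_magnetisation
    (integral_magnetisation_sub_sq_mul_gibbsWeight_pos hlam J _)

end Lattice

end Summit.Ventures.LatticeQCDFlow.Exactness
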